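import Literature.Computability.Complexity.SymmetricThresholdProgramsCounting
import Literature.Combinatorics.SimpleGraph.SwitchingEquivalentGraph
import HarnessLib

/-!
# Symmetric threshold programs: the first-smallest-cell selector

A reusable GADGET for symmetric threshold programs (`SymProg`): the individualisation step of
individualisation–refinement canonisers chooses the FIRST (in colour order) NON-SINGLETON cell of
MINIMAL size; relative to a DATA-DEPENDENT part given by membership wires and a colouring given by
its kernel/order wires (`eq`, `lt`), the gadget raises `sel u` exactly on the vertices of that
cell (route `PneNP/SymmetryBudget`, item `NoHiddenOrder`: the OR-nodes of the Corneil–Goldberg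
tree).  Sizes are compared by the `CmpCount` gadget (`SymmetricThresholdProgramsCounting.lean`),
cell sizes are `cellCard` of `Literature/Combinatorics/SimpleGraph/SwitchingEquivalentGraph.lean`.

* `MinCell.sem_big_iff` — `big a` carries `2 ≤ |cell a|`;
* `MinCell.sem_sel_iff` — `sel a` carries: `a` is a member, `2 ≤ |cell a|`, and every member `b`
  with `2 ≤ |cell b|` has `|cell a| < |cell b|`, or the same size and `col a ≤ col b`.
Gate count `O(|V|²·N)`.

## References
* D. G. Corneil, M. Goldberg, *A non-factorial algorithm for canonical numbering of a graph*,
  J. Algorithms 5 (1984) [CorneilGoldberg1984].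
* M. Anderson, A. Dawar, *On symmetric circuits and fixed-point logics*, Theory Comput. Syst. 60
  (2017), §3 [AndersonDawar2016].
-/

namespace Literature.Computability.Complexity

open Finset Literature.Combinatorics.SimpleGraph

namespace SymProg

variable {ι Λ : Type*} [DecidableEq ι] [DecidableEq Λ] (P : SymProg ι Λ)
variable (V : Type*) [Fintype V] (N : ℕ)

/-- **The first-smallest-cell gadget** inside `P` over the vertex type `V` with count bound `N`
(`N ≥ |part|`). [cite: CorneilGoldberg1984] -/
structure MinCell where
  /-- membership wire of the current part -/
  mem : V → ι ⊕ Λ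
  /-- kernel wire of the colouring: `[col u = col v]` -/
  eq : V → V → ι ⊕ Λ
  /-- order wire of the colouring: `[col u < col v]` -/
  lt : V → V → ι ⊕ Λ
  /-- `cy u y`: `y` is a member of the cell of `u` -/
  cy : V → V → Λ
  /-- `big u`: the cell of `u` has at least two members -/
  big : V → Λ
  /-- the comparison of `|cell v|` with `|cell u|` -/
  cmp : V → V → P.CmpCount N
  /-- `tieLT v u`: equal sizes and `col v < col u` -/
  tieLT : V → V → Λ
  /-- `bo v u`: `|cell v| < |cell u|`, or a tie with `col v < col u` -/
  bo : V → V → Λ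
  /-- `better v u`: `v` is a member with a big cell that comes before the cell of `u` -/
  better : V → V → Λ
  /-- `nobetter u`: no `v` is better -/
  nobetter : V → Λ
  /-- OUTPUT `sel u`: `u` lies in the first smallest non-singleton cell -/
  sel : V → Λ
  cy_injective : ∀ u, Function.Injective (cy u)
  kind_cy : ∀ u y, P.kind (cy u y) = Kind.and
  srcs_cy : ∀ u y, P.srcs (cy u y) = {mem y, eq y u}
  kind_big : ∀ u, P.kind (big u) = Kind.atLeast 2
  srcs_big : ∀ u, P.srcs (big u) = univ.image fun y => Sum.inr (cy u y)
  cmp_A : ∀ v u, (cmp v u).A = univ.image fun y => Sum.inr (cy v y)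
  cmp_B : ∀ v u, (cmp v u).B = univ.image fun y => Sum.inr (cy u y)
  kind_tieLT : ∀ v u, P.kind (tieLT v u) = Kind.and
  srcs_tieLT : ∀ v u, P.srcs (tieLT v u) = {Sum.inr (cmp v u).eq, lt v u}
  kind_bo : ∀ v u, P.kind (bo v u) = Kind.or
  srcs_bo : ∀ v u, P.srcs (bo v u) = {Sum.inr (cmp v u).lt, Sum.inr (tieLT v u)}
  kind_better : ∀ v u, P.kind (better v u) = Kind.and
  srcs_better : ∀ v u, P.srcs (better v u) = {mem v, Sum.inr (big v), Sum.inr (bo v u)}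
  kind_nobetter : ∀ u, P.kind (nobetter u) = Kind.nor
  srcs_nobetter : ∀ u, P.srcs (nobetter u) = univ.image fun v => Sum.inr (better v u)
  kind_sel : ∀ u, P.kind (sel u) = Kind.and
  srcs_sel : ∀ u, P.srcs (sel u) = {mem u, Sum.inr (big u), Sum.inr (nobetter u)}

namespace MinCell

variable {P V N} (M : P.MinCell V N) (x : ι → Bool)

/-- The membership predicate on input `x`. [folklore] -/
def Mem (u : V) : Prop := wval x (P.sem x) (M.mem u) = true

/-- Membership is decidable. [folklore] -/
instance : DecidablePred (M.Mem x) := fun u => by unfold Mem; infer_instance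

/-- The current part on input `x`. [folklore] -/
def part : Finset V := univ.filter fun u => M.Mem x u

/-- Membership in the part. [folklore] -/
theorem mem_part {u : V} : u ∈ M.part x ↔ M.Mem x u := by simp [part]

/-- **Interpretation data**: a colouring of the part whose kernel and order are read by `eq`, `lt`. [folklore] -/
structure Reads (col : M.part x → ℕ) : Prop where
  /-- kernel wires read the kernel of the colouring -/
  eq_iff : ∀ a b : M.part x, wval x (P.sem x) (M.eq a b) = true ↔ col a = col b
  /-- order wires read the order of the colouring -/
  lt_iff : ∀ a b : M.part x, wval x (P.sem x) (M.lt a b) = true ↔ col a < col b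

variable {M x} {col : M.part x → ℕ}

/-- `cy u y` for a member `u`. [folklore] -/
theorem sem_cy (h : M.Reads x col) (u : M.part x) (y : V) :
    P.sem x (M.cy u y) = true ↔ ∃ hy : M.Mem x y, col ⟨y, (M.mem_part x).2 hy⟩ = col u := by
  rw [P.sem_and (M.kind_cy u y), M.srcs_cy]
  simp only [mem_insert, mem_singleton, forall_eq_or_imp, forall_eq]
  constructor
  · rintro ⟨hm, he⟩; exact ⟨hm, (h.eq_iff ⟨y, _⟩ u).1 he⟩
  · rintro ⟨hm, he⟩; exact ⟨hm, (h.eq_iff ⟨y, _⟩ u).2 he⟩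

/-- **The number of `y` with `cy u y` is the size of the cell of `u`.** [folklore] -/
theorem count_cy_eq (h : M.Reads x col) (u : M.part x) :
    P.trueCount x (univ.image fun y => Sum.inr (M.cy u y)) = cellCard col (col u) := by
  unfold trueCount cellCard
  rw [Finset.filter_image, Finset.card_image_of_injective _
    (fun y y' hy => M.cy_injective u (Sum.inr_injective hy))]
  refine Finset.card_bij (fun y hy => ⟨y, (M.mem_part x).2 ((sem_cy h u y).1 (mem_filter.1 hy).2).1⟩) ?_ ?_ ?_
  · intro y hy
    obtain ⟨hm, hc⟩ := (sem_cy h u y).1 (mem_filter.1 hy).2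
    exact mem_filter.2 ⟨mem_univ _, hc⟩
  · intro y _ y' _ hyy
    exact congrArg Subtype.val hyy
  · rintro ⟨y, hyU⟩ hy
    refine ⟨y, mem_filter.2 ⟨mem_univ _, (sem_cy h u y).2 ⟨(M.mem_part x).1 hyU, (mem_filter.1 hy).2⟩⟩, rfl⟩

/-- Cell sizes are bounded by the size of the part. [folklore] -/
theorem cellCard_le (c : ℕ) : cellCard col c ≤ (M.part x).card := by
  unfold cellCard
  exact (Finset.card_filter_le _ _).trans (by rw [Finset.card_univ, Fintype.card_coe])

/-- **`big a` carries `2 ≤ |cell a|`.** [folklore] -/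
theorem sem_big_iff (h : M.Reads x col) (a : M.part x) :
    P.sem x (M.big a) = true ↔ 2 ≤ cellCard col (col a) := by
  rw [P.sem_atLeast_trueCount (M.kind_big a) (M.srcs_big a), count_cy_eq h]

/-- `cmp v u`: size comparisons. [folklore] -/
theorem sem_cmp_lt (h : M.Reads x col) (hN : (M.part x).card ≤ N) (b a : M.part x) :
    P.sem x (M.cmp b a).lt = true ↔ cellCard col (col b) < cellCard col (col a) := by
  have hA : (M.cmp b a).a x = cellCard col (col b) := by
    show P.trueCount x (M.cmp b a).A = _; rw [M.cmp_A, count_cy_eq h]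
  have hB : (M.cmp b a).b x = cellCard col (col a) := by
    show P.trueCount x (M.cmp b a).B = _; rw [M.cmp_B, count_cy_eq h]
  rw [(M.cmp b a).sem_lt x (by rw [hB]; exact (cellCard_le _).trans hN), hA, hB]

/-- `cmp v u`: equal sizes. [folklore] -/
theorem sem_cmp_eq (h : M.Reads x col) (hN : (M.part x).card ≤ N) (b a : M.part x) :
    P.sem x (M.cmp b a).eq = true ↔ cellCard col (col b) = cellCard col (col a) := by
  have hA : (M.cmp b a).a x = cellCard col (col b) := by
    show P.trueCount x (M.cmp b a).A = _; rw [M.cmp_A, count_cy_eq h]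
  have hB : (M.cmp b a).b x = cellCard col (col a) := by
    show P.trueCount x (M.cmp b a).B = _; rw [M.cmp_B, count_cy_eq h]
  rw [(M.cmp b a).sem_eq x (by rw [hA]; exact (cellCard_le _).trans hN)
    (by rw [hB]; exact (cellCard_le _).trans hN), hA, hB]

/-- `better v u` for members. [folklore] -/
theorem sem_better_iff (h : M.Reads x col) (hN : (M.part x).card ≤ N) (b a : M.part x) :
    P.sem x (M.better b a) = true ↔ 2 ≤ cellCard col (col b) ∧
      (cellCard col (col b) < cellCard col (col a) ∨
        (cellCard col (col b) = cellCard col (col a) ∧ col b < col a)) := by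
  rw [P.sem_and (M.kind_better b a), M.srcs_better]
  simp only [mem_insert, mem_singleton, forall_eq_or_imp, forall_eq, wval_inr, sem_big_iff h]
  rw [P.sem_or (M.kind_bo b a), M.srcs_bo]
  simp only [mem_insert, mem_singleton, exists_eq_or_imp, exists_eq_left, wval_inr, sem_cmp_lt h hN]
  rw [P.sem_and (M.kind_tieLT b a), M.srcs_tieLT]
  simp only [mem_insert, mem_singleton, forall_eq_or_imp, forall_eq, wval_inr, sem_cmp_eq h hN, h.lt_iff]
  have hm : wval x (P.sem x) (M.mem b) = true := (M.mem_part x).1 b.2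
  simp only [hm, true_and]

/-- `better v u` is off when `v` is not a member. [folklore] -/
theorem sem_better_of_not_mem {v : V} (hv : ¬ M.Mem x v) (u : V) : P.sem x (M.better v u) = false := by
  rw [← Bool.not_eq_true, P.sem_and (M.kind_better v u), M.srcs_better]
  simp only [mem_insert, mem_singleton, forall_eq_or_imp, forall_eq, not_and]
  intro hm
  exact absurd hm hv

/-- **`sel a` carries "the cell of `a` is the first smallest non-singleton cell".** [cite: CorneilGoldberg1984] -/
theorem sem_sel_iff (h : M.Reads x col) (hN : (M.part x).card ≤ N) (a : M.part x) :
    P.sem x (M.sel a) = true ↔ 2 ≤ cellCard col (col a) ∧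
      ∀ b : M.part x, 2 ≤ cellCard col (col b) →
        cellCard col (col a) < cellCard col (col b) ∨
          (cellCard col (col a) = cellCard col (col b) ∧ col a ≤ col b) := by
  rw [P.sem_and (M.kind_sel a), M.srcs_sel]
  simp only [mem_insert, mem_singleton, forall_eq_or_imp, forall_eq, wval_inr, sem_big_iff h]
  have hm : wval x (P.sem x) (M.mem a) = true := (M.mem_part x).1 a.2
  rw [P.sem_nor (M.kind_nobetter a), M.srcs_nobetter]
  simp only [hm, true_and, mem_image, mem_univ, forall_exists_index, forall_apply_eq_imp_iff,
    wval_inr]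
  refine and_congr_right fun _ => ⟨fun H b hb => ?_, fun H v => ?_⟩
  · have := H b
    rw [← Bool.not_eq_true, sem_better_iff h hN] at this
    rcases lt_trichotomy (cellCard col (col a)) (cellCard col (col b)) with h1 | h1 | h1
    · exact Or.inl h1
    · right
      refine ⟨h1, not_lt.1 fun hlt => this ⟨hb, Or.inr ⟨h1.symm, hlt⟩⟩⟩
    · exact absurd ⟨hb, Or.inl h1⟩ this
  · by_cases hv : M.Mem x v
    · rw [← Bool.not_eq_true, sem_better_iff h hN ⟨v, (M.mem_part x).2 hv⟩]
      rintro ⟨hb, hlt | ⟨heq, hlt⟩⟩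
      · rcases H ⟨v, _⟩ hb with h1 | ⟨h1, _⟩
        · exact lt_asymm h1 hlt
        · exact absurd h1 hlt.ne'
      · rcases H ⟨v, _⟩ hb with h1 | ⟨_, h2⟩
        · exact absurd heq.symm h1.ne
        · exact absurd hlt (not_lt.2 h2)
    · exact sem_better_of_not_mem hv a

end MinCell

end SymProg

end Literature.Computability.Complexity
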